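import Mathlib
import HarnessLib

/-!
# Crux `DescentPerfectToAll` (stmt-ResolutionOfSingularities-0549) — lens 5, g9: PORT-READY §1 of THEOREM T
# («graded valuation basis»: pairwise distinct values ⇒ the value of a sum is the maximum ⇒ linear independence over a subfield;
#  applied to the `p²` monomials `x^a y^b` under (V) + (P2))

SUPPORT workfile (res-B-lens-5 g9, 2026-08-29).  OURS · counted 0.  Nothing here proves resolution in characteristic `p`; no crux or
stub is proved here.  These are the elementary valuation-theoretic lemmas behind memo `CLASSBC-prank2-toric-lens5-g9.md` §1 (PB)/(PB0),
self-contained over Mathlib, offered to the line lead of stmt-15917 for the kernel port of THEOREM T: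
* `valuation_sum_eq_sup_of_pairwise` ✓ — if the non-zero terms of a finite sum have pairwise distinct values, `v (∑ f i) = sup v (f i)`;
* `linearIndependent_of_valuation_pairwise` ✓ — a finite family `b` with `v (m b_i) ≠ v (m' b_j)` for `i ≠ j` and non-zero `m, m'` in a
  subfield `M` is linearly independent over `M`;
* `pRankTwo_zpow` ✓ — (P2) with INTEGER exponents: `v (x^a y^b z^p) ≠ v (z'^p)` unless `p ∣ a` and `p ∣ b`;
* `monomial_values_ne` ✓ / `monomials_linearIndependent` ✓ — under (V) «every non-zero element of `M` has the value of a `p`-th power»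
  and (P2), the products `m · x^a y^b` (`a, b < p`) have pairwise distinct values and `{x^a y^b}` is linearly independent over `M`
  (so it is an `M`-basis of `K` as soon as `[K : M] ≤ p²` — the degree count is not done here).
Resolution of singularities in positive characteristic is NOT proved.
-/

noncomputable section

set_option linter.dupNamespace false

namespace Summit.ResolutionOfSingularities.ResolutionOfSingularities.Cruxes.DescentPerfectToAll.CpSibling.GradedBasis

variable {K : Type} [Field K] {Γ₀ : Type} [LinearOrderedCommGroupWithZero Γ₀]

/-- **Graded sums.** If the non-zero terms of a finite sum have pairwise distinct values, the value of the sum is the largest value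
(multiplicative notation: `v 0 = 0` is the bottom). [folklore] -/
theorem valuation_sum_eq_sup_of_pairwise (v : Valuation K Γ₀) {ι : Type} [DecidableEq ι] (s : Finset ι) (f : ι → K)
    (h : ∀ i ∈ s, ∀ j ∈ s, i ≠ j → f i ≠ 0 → v (f i) ≠ v (f j)) :
    v (∑ i ∈ s, f i) = s.sup (fun i => v (f i)) := by
  rcases s.eq_empty_or_nonempty with rfl | hne
  · simp [bot_eq_zero]
  obtain ⟨j, hj, hmax⟩ := Finset.exists_max_image s (fun i => v (f i)) hne
  have hsup : s.sup (fun i => v (f i)) = v (f j) :=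
    le_antisymm (Finset.sup_le fun i hi => hmax i hi) (Finset.le_sup (f := fun i => v (f i)) hj)
  rw [hsup]
  by_cases hj0 : f j = 0
  · have hall : ∀ i ∈ s, f i = 0 := by
      intro i hi
      have hle := hmax i hi
      rw [hj0, map_zero] at hle
      exact (Valuation.zero_iff v).mp (le_antisymm hle zero_le)
    rw [Finset.sum_eq_zero hall, hj0]
  · apply Valuation.map_sum_eq_of_lt v hj
    intro i hi
    rw [Finset.mem_sdiff, Finset.mem_singleton] at hi
    rcases eq_or_ne (f i) 0 with hi0 | hi0
    · rw [hi0, map_zero]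
      exact zero_lt_iff.mpr ((Valuation.ne_zero_iff v).mpr hj0)
    · exact lt_of_le_of_ne (hmax i hi.1) (h i hi.1 j hj hi.2 hi0)

/-- Corollary: a graded sum vanishes only if every term vanishes. [folklore] -/
theorem eq_zero_of_sum_eq_zero_of_pairwise (v : Valuation K Γ₀) {ι : Type} [DecidableEq ι] (s : Finset ι) (f : ι → K)
    (h : ∀ i ∈ s, ∀ j ∈ s, i ≠ j → f i ≠ 0 → v (f i) ≠ v (f j)) (hsum : ∑ i ∈ s, f i = 0) :
    ∀ i ∈ s, f i = 0 := by
  intro i hi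
  have hsup := valuation_sum_eq_sup_of_pairwise v s f h
  rw [hsum, map_zero] at hsup
  have hle : v (f i) ≤ s.sup (fun i => v (f i)) := Finset.le_sup (f := fun i => v (f i)) hi
  rw [← hsup] at hle
  exact (Valuation.zero_iff v).mp (le_antisymm hle zero_le)

/-- **Linear independence from values.** A finite family `b` of non-zero elements such that `v (m · b i) ≠ v (m' · b j)` whenever `i ≠ j`
and `m, m'` are non-zero elements of a subfield `M` is linearly independent over `M`. [folklore] -/
theorem linearIndependent_of_valuation_pairwise (v : Valuation K Γ₀) (M : Subfield K) {ι : Type} [Fintype ι] [DecidableEq ι]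
    (b : ι → K) (hb : ∀ i, b i ≠ 0)
    (h : ∀ i j, i ≠ j → ∀ m m' : K, m ∈ M → m' ∈ M → m ≠ 0 → m' ≠ 0 → v (m * b i) ≠ v (m' * b j)) :
    LinearIndependent M b := by
  rw [Fintype.linearIndependent_iff]
  intro g hg i
  have hsum : ∑ i, (g i : K) * b i = 0 := by
    have : ∑ i, (g i : K) * b i = ∑ i, g i • b i :=
      Finset.sum_congr rfl fun i _ => (Subfield.smul_def (g i) (b i)).symm
    rw [this, hg]
  have hpw : ∀ i ∈ (Finset.univ : Finset ι), ∀ j ∈ (Finset.univ : Finset ι), i ≠ j → (g i : K) * b i ≠ 0 →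
      v ((g i : K) * b i) ≠ v ((g j : K) * b j) := by
    intro i _ j _ hij hi0
    have hgi : (g i : K) ≠ 0 := fun h0 => hi0 (by rw [h0, zero_mul])
    by_cases hgj : (g j : K) = 0
    · rw [hgj, zero_mul, map_zero]
      exact (Valuation.ne_zero_iff v).mpr hi0
    · exact h i j hij (g i) (g j) (g i).2 (g j).2 hgi hgj
  have h0 := eq_zero_of_sum_eq_zero_of_pairwise v Finset.univ (fun i => (g i : K) * b i) hpw hsum i (Finset.mem_univ i)
  rcases mul_eq_zero.mp h0 with h1 | h1
  · exact_mod_cast h1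
  · exact absurd h1 (hb i)

/-- **(P2) with integer exponents.** If no monomial `x^a y^b` (`0 ≤ a, b < p`, not both `0`) has the value of a `p`-th power, then
`v (x^a y^b z^p) ≠ v (z'^p)` for all integers `a, b` not both divisible by `p` and all non-zero `z, z'` (Euclidean division of the
exponents). [folklore] -/
theorem pRankTwo_zpow {p : ℕ} (hp : p.Prime) (v : Valuation K Γ₀) {x y : K} (hx : x ≠ 0) (hy : y ≠ 0)
    (hP : ∀ a b : ℕ, a < p → b < p → (a ≠ 0 ∨ b ≠ 0) → ∀ z : K, z ≠ 0 → v (x ^ a * y ^ b) ≠ v (z ^ p))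
    (a b : ℤ) (hab : ¬ ((p : ℤ) ∣ a ∧ (p : ℤ) ∣ b)) (z z' : K) (hz : z ≠ 0) (hz' : z' ≠ 0) :
    v (x ^ a * y ^ b * z ^ p) ≠ v (z' ^ p) := by
  have hp0 : (p : ℤ) ≠ 0 := by exact_mod_cast hp.ne_zero
  have hppos : (0 : ℤ) < p := by exact_mod_cast hp.pos
  -- Euclidean division of the exponents
  set qa := a / p with hqa
  set qb := b / p with hqb
  set ra := (a % p).toNat with hra
  set rb := (b % p).toNat with hrb
  have hra0 : (0 : ℤ) ≤ a % p := Int.emod_nonneg a hp0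
  have hrb0 : (0 : ℤ) ≤ b % p := Int.emod_nonneg b hp0
  have hraZ : (ra : ℤ) = a % p := Int.toNat_of_nonneg hra0
  have hrbZ : (rb : ℤ) = b % p := Int.toNat_of_nonneg hrb0
  have hra_lt : ra < p := by
    have := Int.emod_lt_of_pos a hppos
    omega
  have hrb_lt : rb < p := by
    have := Int.emod_lt_of_pos b hppos
    omega
  have hdecomp_a : a = (p : ℤ) * qa + ra := by rw [hraZ, hqa]; linarith [Int.mul_ediv_add_emod a (p : ℤ)]
  have hdecomp_b : b = (p : ℤ) * qb + rb := by rw [hrbZ, hqb]; linarith [Int.mul_ediv_add_emod b (p : ℤ)]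
  -- not both remainders vanish
  have hrab : ra ≠ 0 ∨ rb ≠ 0 := by
    by_contra hcon
    push Not at hcon
    apply hab
    constructor
    · rw [Int.dvd_iff_emod_eq_zero, ← hraZ]; exact_mod_cast hcon.1
    · rw [Int.dvd_iff_emod_eq_zero, ← hrbZ]; exact_mod_cast hcon.2
  -- the field identity `x^a y^b z^p = (x^qa y^qb z)^p · (x^ra y^rb)`
  set w : K := x ^ qa * y ^ qb * z with hw
  have hw0 : w ≠ 0 := mul_ne_zero (mul_ne_zero (zpow_ne_zero _ hx) (zpow_ne_zero _ hy)) hz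
  have hxa : x ^ a = (x ^ qa) ^ p * x ^ ra := by
    rw [hdecomp_a, zpow_add₀ hx, mul_comm (p : ℤ) qa, zpow_mul, zpow_natCast, zpow_natCast]
  have hyb : y ^ b = (y ^ qb) ^ p * y ^ rb := by
    rw [hdecomp_b, zpow_add₀ hy, mul_comm (p : ℤ) qb, zpow_mul, zpow_natCast, zpow_natCast]
  have hident : x ^ a * y ^ b * z ^ p = w ^ p * (x ^ ra * y ^ rb) := by
    rw [hxa, hyb, hw, mul_pow, mul_pow]; ring
  intro heq
  rw [hident] at heq
  -- divide by `w^p`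
  have hwp0 : v (w ^ p) ≠ 0 := (Valuation.ne_zero_iff v).mpr (pow_ne_zero _ hw0)
  have heq2 : v (w ^ p) * v (x ^ ra * y ^ rb) = v (z' ^ p) := by rw [← map_mul]; exact heq
  have hmono : v (x ^ ra * y ^ rb) = v ((z' / w) ^ p) := by
    rw [div_pow, map_div₀, ← heq2, mul_div_cancel_left₀ _ hwp0]
  exact hP ra rb hra_lt hrb_lt hrab (z' / w) (div_ne_zero hz' hw0) hmono

/-- **Pairwise distinct values of the `p²` monomials** (memo §1 (PB)): under (V) «every non-zero element of the subfield `M` has the value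
of a `p`-th power» and (P2), `v (m x^a y^b) ≠ v (m' x^{a'} y^{b'})` for `(a, b) ≠ (a', b')` in `{0..p-1}²` and non-zero `m, m' ∈ M`.
[folklore] -/
theorem monomial_values_ne {p : ℕ} (hp : p.Prime) (v : Valuation K Γ₀) (M : Subfield K)
    (hV : ∀ m : K, m ∈ M → m ≠ 0 → ∃ z : K, z ≠ 0 ∧ v m = v (z ^ p))
    {x y : K} (hx : x ≠ 0) (hy : y ≠ 0)
    (hP : ∀ a b : ℕ, a < p → b < p → (a ≠ 0 ∨ b ≠ 0) → ∀ z : K, z ≠ 0 → v (x ^ a * y ^ b) ≠ v (z ^ p))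
    (ab ab' : Fin p × Fin p) (hne : ab ≠ ab') (m m' : K) (hm : m ∈ M) (hm' : m' ∈ M) (hm0 : m ≠ 0) (hm0' : m' ≠ 0) :
    v (m * (x ^ (ab.1 : ℕ) * y ^ (ab.2 : ℕ))) ≠ v (m' * (x ^ (ab'.1 : ℕ) * y ^ (ab'.2 : ℕ))) := by
  obtain ⟨z, hz, hmz⟩ := hV m hm hm0
  obtain ⟨z', hz', hmz'⟩ := hV m' hm' hm0'
  intro heq
  -- exponent differences, as integers, are not both divisible by `p`
  set e₁ : ℤ := (ab.1 : ℕ) - (ab'.1 : ℕ) with he₁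
  set e₂ : ℤ := (ab.2 : ℕ) - (ab'.2 : ℕ) with he₂
  have hdiv : ¬ ((p : ℤ) ∣ e₁ ∧ (p : ℤ) ∣ e₂) := by
    rintro ⟨h₁, h₂⟩
    have hlt₁ : e₁.natAbs < (p : ℤ).natAbs := by
      have := ab.1.isLt; have := ab'.1.isLt; simp only [Int.natAbs_natCast]; omega
    have hlt₂ : e₂.natAbs < (p : ℤ).natAbs := by
      have := ab.2.isLt; have := ab'.2.isLt; simp only [Int.natAbs_natCast]; omega
    have h₁0 := Int.eq_zero_of_dvd_of_natAbs_lt_natAbs h₁ hlt₁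
    have h₂0 := Int.eq_zero_of_dvd_of_natAbs_lt_natAbs h₂ hlt₂
    apply hne
    have hfst : ab.1 = ab'.1 := by apply Fin.ext; omega
    have hsnd : ab.2 = ab'.2 := by apply Fin.ext; omega
    exact Prod.ext hfst hsnd
  -- the integer-exponent monomial `x^e₁ y^e₂ z^p` has the value of `z'^p`
  apply pRankTwo_zpow hp v hx hy hP e₁ e₂ hdiv z z' hz hz'
  -- from `heq`: `v m · v(x^a y^b) = v m' · v(x^a' y^b')`
  have hxab0 : x ^ (ab'.1 : ℕ) * y ^ (ab'.2 : ℕ) ≠ 0 := mul_ne_zero (pow_ne_zero _ hx) (pow_ne_zero _ hy)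
  have hident : x ^ e₁ * y ^ e₂ * z ^ p =
      (x ^ (ab.1 : ℕ) * y ^ (ab.2 : ℕ)) / (x ^ (ab'.1 : ℕ) * y ^ (ab'.2 : ℕ)) * z ^ p := by
    rw [he₁, he₂, zpow_sub₀ hx, zpow_sub₀ hy, zpow_natCast, zpow_natCast, zpow_natCast, zpow_natCast]
    field_simp
  rw [hident, map_mul, map_div₀]
  -- `v(x^a y^b) / v(x^a' y^b') = v m' / v m = v(z'^p) / v(z^p)`
  have hvm0 : v m ≠ 0 := (Valuation.ne_zero_iff v).mpr hm0
  have hvab0 : v (x ^ (ab'.1 : ℕ) * y ^ (ab'.2 : ℕ)) ≠ 0 := (Valuation.ne_zero_iff v).mpr hxab0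
  have hvz0 : v (z ^ p) ≠ 0 := (Valuation.ne_zero_iff v).mpr (pow_ne_zero _ hz)
  have heq' : v m * v (x ^ (ab.1 : ℕ) * y ^ (ab.2 : ℕ)) = v m' * v (x ^ (ab'.1 : ℕ) * y ^ (ab'.2 : ℕ)) := by
    rw [← map_mul, ← map_mul]; exact heq
  -- rearrange
  have hratio : v (x ^ (ab.1 : ℕ) * y ^ (ab.2 : ℕ)) / v (x ^ (ab'.1 : ℕ) * y ^ (ab'.2 : ℕ)) = v m' / v m := by
    rw [div_eq_div_iff hvab0 hvm0]
    calc v (x ^ (ab.1 : ℕ) * y ^ (ab.2 : ℕ)) * v m = v m * v (x ^ (ab.1 : ℕ) * y ^ (ab.2 : ℕ)) := mul_comm _ _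
      _ = v m' * v (x ^ (ab'.1 : ℕ) * y ^ (ab'.2 : ℕ)) := heq'
  rw [hratio, hmz, hmz']
  exact div_mul_cancel₀ _ hvz0

/-- **Graded valuation basis, independence half** (memo §1 (PB)): under (V) and (P2) the `p²` monomials `x^a y^b` (`0 ≤ a, b < p`) are
linearly independent over the subfield `M`. [folklore] -/
theorem monomials_linearIndependent {p : ℕ} (hp : p.Prime) (v : Valuation K Γ₀) (M : Subfield K)
    (hV : ∀ m : K, m ∈ M → m ≠ 0 → ∃ z : K, z ≠ 0 ∧ v m = v (z ^ p))
    {x y : K} (hx : x ≠ 0) (hy : y ≠ 0)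
    (hP : ∀ a b : ℕ, a < p → b < p → (a ≠ 0 ∨ b ≠ 0) → ∀ z : K, z ≠ 0 → v (x ^ a * y ^ b) ≠ v (z ^ p)) :
    LinearIndependent M (fun ab : Fin p × Fin p => x ^ (ab.1 : ℕ) * y ^ (ab.2 : ℕ)) := by
  classical
  apply linearIndependent_of_valuation_pairwise v M
  · intro ab; exact mul_ne_zero (pow_ne_zero _ hx) (pow_ne_zero _ hy)
  · intro i j hij m m' hm hm' hm0 hm0'
    exact monomial_values_ne hp v M hV hx hy hP i j hij m m' hm hm' hm0 hm0'

/-- **Graded valuation basis, grading half** (memo §1 (PB)): under (V) and (P2), the value of `Σ m_{ab} x^a y^b` (`m_{ab} ∈ M`) is the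
largest value of its terms; in particular each term of an element of `O_v` lies in `O_v`. [folklore] -/
theorem valuation_sum_monomials_eq_sup {p : ℕ} (hp : p.Prime) (v : Valuation K Γ₀) (M : Subfield K)
    (hV : ∀ m : K, m ∈ M → m ≠ 0 → ∃ z : K, z ≠ 0 ∧ v m = v (z ^ p))
    {x y : K} (hx : x ≠ 0) (hy : y ≠ 0)
    (hP : ∀ a b : ℕ, a < p → b < p → (a ≠ 0 ∨ b ≠ 0) → ∀ z : K, z ≠ 0 → v (x ^ a * y ^ b) ≠ v (z ^ p))
    (m : Fin p × Fin p → K) (hm : ∀ ab, m ab ∈ M) :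
    v (∑ ab, m ab * (x ^ (ab.1 : ℕ) * y ^ (ab.2 : ℕ))) =
      Finset.univ.sup (fun ab => v (m ab * (x ^ (ab.1 : ℕ) * y ^ (ab.2 : ℕ)))) := by
  classical
  apply valuation_sum_eq_sup_of_pairwise v Finset.univ
  intro i _ j _ hij hi0
  have hmi : m i ≠ 0 := fun h0 => hi0 (by rw [h0, zero_mul])
  by_cases hmj : m j = 0
  · rw [hmj, zero_mul, map_zero]
    exact (Valuation.ne_zero_iff v).mpr hi0
  · exact monomial_values_ne hp v M hV hx hy hP i j hij (m i) (m j) (hm i) (hm j) hmi hmj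

/-- Each term of a graded sum is bounded by the sum: `v (m_{ab} x^a y^b) ≤ v (Σ …)`; hence if the sum lies in a valuation ring so does
every term (memo §1: «each graded piece of an element of `O_v` is in `O_v`»). [folklore] -/
theorem valuation_term_le_sum {p : ℕ} (hp : p.Prime) (v : Valuation K Γ₀) (M : Subfield K)
    (hV : ∀ m : K, m ∈ M → m ≠ 0 → ∃ z : K, z ≠ 0 ∧ v m = v (z ^ p))
    {x y : K} (hx : x ≠ 0) (hy : y ≠ 0)
    (hP : ∀ a b : ℕ, a < p → b < p → (a ≠ 0 ∨ b ≠ 0) → ∀ z : K, z ≠ 0 → v (x ^ a * y ^ b) ≠ v (z ^ p))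
    (m : Fin p × Fin p → K) (hm : ∀ ab, m ab ∈ M) (ab₀ : Fin p × Fin p) :
    v (m ab₀ * (x ^ (ab₀.1 : ℕ) * y ^ (ab₀.2 : ℕ))) ≤ v (∑ ab, m ab * (x ^ (ab.1 : ℕ) * y ^ (ab.2 : ℕ))) := by
  classical
  rw [valuation_sum_monomials_eq_sup hp v M hV hx hy hP m hm]
  exact Finset.le_sup (f := fun ab => v (m ab * (x ^ (ab.1 : ℕ) * y ^ (ab.2 : ℕ)))) (Finset.mem_univ ab₀)

end Summit.ResolutionOfSingularities.ResolutionOfSingularities.Cruxes.DescentPerfectToAll.CpSibling.GradedBasis
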